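import Literature.Barriers.HubbardSuperconductivity.SignProblemNPHardMachines
import Literature.Computability.Complexity.CookLevinSAT
import HarnessLib

/-!
# Discharge of the barrier `SignProblemNPHard` (Troyer–Wiese 2005): `NP ⊆ P^O` for every thermal-energy oracle

`SignProblemNPHard_holds : SignProblemNPHard` — for every oracle `O` that answers the thermal
energies of unit-coupling Ising systems at unary inverse temperature and accuracy
(`IsIsingThermalOracle O`, the tree's abstraction of "a solution of the sign problem" for
Troyer–Wiese's family, `SignProblemNPHard.lean`), `NP ⊆ P^O`.

Troyer–Wiese's printed argument [cite: TroyerWiese2005, Letter p. 4]: the ground-state question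
of an Ising spin glass with couplings `0, ±J` is `NP`-complete, and "by choosing an inverse
temperature `βJ ≥ N ln 2 + ln(12N)` the thermal average of the energy will be less than
`E₀ + J/2` if at least one configuration with energy `E₀` or less exists, and larger than `E₀ + J`
otherwise", so one thermal average decides it. The Lean proof follows it with the tree's proved
source of `NP`-hardness, the Cook–Levin theorem, in place of Barahona's theorem:

* `isNPHard_of_encode_iff`: any language containing the code of a CNF iff the CNF is satisfiable
  is `NP`-hard, because the tree's Cook–Levin reduction `CookLevin.reduceSAT`
  (`SAT_isNPHard_holds`, `CookLevinSAT.lean`) outputs CNF codes.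
* `SatIsing = {z | ∃ σ, E_{J(toks z)}(σ) ≤ -N(z)}` — the Ising ground-state question for the
  instance read off `z` by the tokenizer of `SignProblemNPHardMachines.lean` — contains the code
  of `φ` iff `φ` is satisfiable (`encode_mem_SatIsing_iff`: `toks_encode` and the gadget theorem
  `CNFIsing.exists_energy_le_threshold_iff` of `SignProblemNPHardGadget.lean`, variables renamed
  into binary along the injection `encodeNat`); hence `satIsing_isNPHard`.
* `signAlg`, the one-query oracle algorithm "ask `qryFn z` (the thermal energy of `J(toks z)` at
  `β = 3n + 3`, accuracy `1/4`), output `decFn ⟨z, answer⟩`", is polynomial-time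
  (`isPolyTime_signAlg`, its step as the `FP` string map `stepB`), asks only `qryFn z`
  (`eq_of_mem_queries_signAlg`, polynomially long by `exists_poly_length_le_of_mem_FP`) and
  outputs `[z ∈ SatIsing]` (`verdict_eq_boolIndicator`: `3n + 3 ≥ n ln 2 + ln(12 n)`
  (`lowTemperature_le`, elementary) and Troyer–Wiese's low-temperature lemma
  `lowTemperature_thermalEnergy_decides_holds` with `E₀ = -N(z)`): `satIsing_mem_PRel`.
* Assembly: `NP ∋ L ≤ₚ SatIsing` (Karp) `⇒ L ≤ᵀₚ SatIsing` (`PolyTimeKarpReducible.turing_holds`)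
  `⇒ L ∈ P^O` (`mem_PRel_of_polyTimeTuringReducible_holds`, closure of `P^O` under Cook
  reductions).

What is NOT proved here: the named facts `isingGround_isNPComplete` and
`signProblem_decides_isingGround` of `SignProblemNPHard.lean` about the specific language
`ISINGGROUND` (matrix-coded instances); the barrier follows from the analogous statements for
`SatIsing` (`satIsing_isNPHard`, `signProblem_decides_satIsing`), which differ from them only in the
coding of instances.

## References

* M. Troyer, U.-J. Wiese, *Computational complexity and fundamental limitations to fermionic
  quantum Monte Carlo simulations*, PRL 94 (2005) 170201, abstract and Letter p. 4.
* S. Arora, B. Barak, *Computational Complexity: A Modern Approach*, CUP 2009, Lemma 2.11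
  (Cook–Levin), §3.4 (oracle machines).
* R. E. Ladner, N. A. Lynch, A. L. Selman, Theoret. Comput. Sci. 1 (1975), §2 (`≤ₘᴾ ⇒ ≤ᵀᴾ`,
  transitivity).
-/

noncomputable section

namespace Literature.Barriers.HubbardSuperconductivity

open _root_.Computability Literature.Computability.Complexity Literature.Computability.Complexity.Nondeterministic
  Brick OracleCompose PRelSigma TTClosure Polynomial CNFIsing

/-! ### `NP`-hardness read off CNF codes -/

/-- **Cook–Levin, transported**: a language containing the code of a CNF iff the CNF is satisfiable
is `NP`-hard — the tree's Cook–Levin reduction `CookLevin.reduceSAT` outputs CNF codes, so it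
reduces every `NP` language to any such language. [cite: AroraBarakCC2009, Lemma 2.11] -/
theorem isNPHard_of_encode_iff {X : Language Bool}
    (hX : ∀ φ : CNF ℕ, encodingCNF.encode φ ∈ X ↔ φ.Satisfiable) : IsNPHard X := by
  rintro L ⟨L', hL', p, hp⟩
  obtain ⟨q, Mx, hM⟩ := mem_P_iff_holds.1 hL'
  refine ⟨CookLevin.reduceSAT Mx p q, CookLevin.reduceSAT_mem_FP Mx p q, fun x => (hp x).trans ?_⟩
  have h1 := CookLevin.reduceSAT_mem_SAT_iff Mx p q
    (f := fun a => (L' : Set (List Bool)).boolIndicator a) (fun a => hM a) x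
  have h2 : CookLevin.reduceSAT Mx p q x ∈ X ↔ CookLevin.reduceSAT Mx p q x ∈ SAT := by
    rw [CookLevin.reduceSAT, hX, mem_SAT_iff]
  refine Iff.trans ?_ (h2.trans h1).symm
  exact exists_congr fun u => and_congr Iff.rfl (Set.mem_iff_boolIndicator (L' : Set (List Bool)) (boolPair x u))


/-! ### The language decided with one thermal-energy query -/

/-- **`SatIsing`**: the strings `z` whose Ising instance `J(toks z)` (read off `z` by the tokenizer
of `SignProblemNPHardMachines.lean`) has a configuration of energy `≤ -N(z)`. [folklore] -/
def SatIsing : Language Bool :=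
  {z | ∃ σ, isingEnergy (matrixOf z) σ ≤ -(thresholdN z : ℤ)}

/-- Membership in `SatIsing` (definitional). [folklore] -/
theorem mem_SatIsing_iff (z : List Bool) :
    z ∈ SatIsing ↔ ∃ σ, isingEnergy (matrixOf z) σ ≤ -(thresholdN z : ℤ) :=
  Iff.rfl

/-- Ground-state questions of equal token lists agree. [folklore] -/
theorem exists_energy_le_congr {T T' : List STok} (h : T = T') (K : ℤ) :
    (∃ σ, isingEnergy (J T) σ ≤ K) ↔ ∃ σ, isingEnergy (J T') σ ≤ K := by
  subst h; rfl

/-- **The code of a CNF is in `SatIsing` iff the CNF is satisfiable** (the gadget theorem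
`exists_energy_le_threshold_iff` through the tokenizer on valid codes). [folklore] -/
theorem encode_mem_SatIsing_iff (φ : CNF ℕ) : encodingCNF.encode φ ∈ SatIsing ↔ φ.Satisfiable := by
  have hT : toks (encodingCNF.encode φ) = tokens (φ.map fun c => c.map strLit) := toks_encode φ
  rw [mem_SatIsing_iff]
  refine (exists_energy_le_congr (T := toks (encodingCNF.encode φ)) hT _).trans ?_
  have hK : -(thresholdN (encodingCNF.encode φ) : ℤ) = threshold (φ.map fun c => c.map strLit) := by
    simp only [thresholdN, threshold, hT, clauseCount_encode, List.length_map]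
  rw [hK, exists_energy_le_threshold_iff]
  exact CookLevin.satisfiable_map_renLit_iff (f := encodeNat) encodingNatBool.encode_injective φ

/-- **`SatIsing` is `NP`-hard.** [folklore] -/
theorem satIsing_isNPHard : IsNPHard SatIsing :=
  isNPHard_of_encode_iff encode_mem_SatIsing_iff

/-! ### The one-query oracle algorithm -/

/-- **The sign-problem oracle algorithm**: on input `z` ask the thermal energy of `J(toks z)` at
`β = 3n + 3` to accuracy `1/4` (`qryFn z`), then compare the answer with the threshold (`decFn`).
[cite: TroyerWiese2005, Letter p. 4] -/
def signAlg : OracleAlg Bool where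
  step x ans := if ans.length < 1 then Sum.inl (qryFn x) else Sum.inr ((decFn (boolPair x (ans.headD []))).headD false)

/-- The step on the empty transcript is the query. [folklore] -/
theorem signAlg_step_nil (x : List Bool) : signAlg.step x [] = Sum.inl (qryFn x) := rfl

/-- The step after an answer is the verdict. [folklore] -/
theorem signAlg_step_cons (x a : List Bool) (rest : List (List Bool)) :
    signAlg.step x (a :: rest) = Sum.inr ((decFn (boolPair x a)).headD false) := by
  simp [signAlg]

/-- **The run**: with at least two rounds, `signAlg` outputs the verdict on the oracle's answer to
its single query. [folklore] -/
theorem run_signAlg (O : Oracle) (x : List Bool) {k : ℕ} (hk : 1 < k) :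
    signAlg.run O k x = some ((decFn (boolPair x (O (qryFn x)))).headD false) := by
  have h0 : trans signAlg O x 0 = [] := rfl
  have h1 : trans signAlg O x 1 = [O (qryFn x)] := by
    rw [trans_succ, h0, qryOf_eq_of_step_eq (signAlg_step_nil x)]
    rfl
  rw [run_eq_some_iff]
  refine ⟨1, hk, fun i hi => ?_, ?_⟩
  · obtain rfl : i = 0 := by omega
    exact ⟨qryFn x, by rw [h0, signAlg_step_nil]⟩
  · rw [h1, signAlg_step_cons]

/-- **The queries**: every recorded query of `signAlg` is `qryFn x`. [folklore] -/
theorem eq_of_mem_queries_signAlg (O : Oracle) (x : List Bool) (k : ℕ) {y : List Bool}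
    (hy : y ∈ signAlg.queries O k x) : y = qryFn x := by
  obtain ⟨i, -, hall, rfl⟩ := exists_of_mem_queries _ _ k x y hy
  have h0 : trans signAlg O x 0 = [] := rfl
  have h1 : trans signAlg O x 1 = [O (qryFn x)] := by
    rw [trans_succ, h0, qryOf_eq_of_step_eq (signAlg_step_nil x)]
    rfl
  rcases i with _ | i
  · rw [h0, qryOf_eq_of_step_eq (signAlg_step_nil x)]
  · obtain ⟨y', hy'⟩ := hall 1 (by omega)
    rw [h1, signAlg_step_cons] at hy'
    cases hy'

/-- The output branch of the step as a string map: `1 · decFn ⟨x, first answer⟩`. [folklore] -/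
def outB : List Bool → List Bool :=
  List.cons true ∘ decFn ∘ pairFn fstP (fstP ∘ bodA)

/-- **The step of `signAlg` as a string map.** [folklore] -/
def stepB : List Bool → List Bool :=
  condFn (GoOn 1) (qryS (qryFn ∘ fstP)) outB

/-- `outB ∈ FP`. [folklore] -/
theorem outB_mem_FP : outB ∈ FP :=
  comp_mem_FP (cons_mem_FP true) (comp_mem_FP decFn_mem_FP (pairFn_mem_FP fstP_mem_FP (comp_mem_FP fstP_mem_FP bodA_mem_FP)))

/-- `stepB ∈ FP`. [folklore] -/
theorem stepB_mem_FP : stepB ∈ FP :=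
  condFn_mem_FP (GoOn_mem_P 1) (qryS_mem_FP (comp_mem_FP qryFn_mem_FP fstP_mem_FP)) outB_mem_FP

/-- The output branch on a coded pair. [folklore] -/
theorem outB_apply (x : List Bool) (ans : List (List Bool)) :
    outB (boolPair x ((encodingList Bool).listBool.encode ans)) = true :: decFn (boolPair x (ans.headD [])) := by
  rw [outB, Function.comp_apply, Function.comp_apply, pairFn_apply, fstP_boolPair, Function.comp_apply, bodA_apply]
  cases ans with
  | nil => rfl
  | cons a rest => rw [body_cons, fstP_boolPair]; rfl

/-- **The string map computes the step function.** [folklore] -/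
theorem stepB_apply (x : List Bool) (ans : List (List Bool)) :
    stepB (boolPair x ((encodingList Bool).listBool.encode ans)) = stepCode (signAlg.step x ans) := by
  by_cases h : ans.length < 1
  · have hnil : ans = [] := List.eq_nil_of_length_eq_zero (by omega)
    subst hnil
    rw [stepB, condFn_of_mem _ _ ((mem_GoOn_iff x []).2 (by simp)), qryS_apply, signAlg_step_nil, stepCode_inl,
      Function.comp_apply, fstP_boolPair]
  · have hne : ans ≠ [] := by rintro rfl; simp at h
    obtain ⟨a, rest, rfl⟩ := List.exists_cons_of_ne_nil hne
    rw [stepB, condFn_of_not_mem _ _ (fun h' => h (by simpa using (mem_GoOn_iff x _).1 h')), outB_apply,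
      signAlg_step_cons,
      stepCode_inr]
    obtain ⟨b, hb⟩ := oneBit_decFn (boolPair x a)
    simp [hb]

/-- **`signAlg` is polynomial-time.** [folklore] -/
theorem isPolyTime_signAlg : signAlg.IsPolyTime encodingBoolBool := by
  obtain ⟨p, Mx, h⟩ := stepB_mem_FP
  refine ⟨p, Mx, fun z => ?_⟩
  have hz := h (boolPair z.1 ((encodingList Bool).listBool.encode z.2))
  rw [id, stepB_apply] at hz
  exact hz

/-! ### Thermal oracles decide `SatIsing` -/

/-- The inverse temperature `3n + 3` reaches Troyer–Wiese's `n ln 2 + ln(12 n)` (elementary: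
`ln 2 ≤ 1`, `ln n ≤ n - 1`, `ln 12 ≤ 4` as `e ≥ 2`). [folklore] -/
theorem lowTemperature_le (n : ℕ) (hn : 1 ≤ n) : (n : ℝ) * Real.log 2 + Real.log (12 * n) ≤ ((3 * n + 3 : ℕ) : ℝ) := by
  have hn' : (1 : ℝ) ≤ n := by exact_mod_cast hn
  have h2 : Real.log 2 ≤ 1 := by
    have := Real.log_le_sub_one_of_pos (x := 2) (by norm_num)
    linarith
  have hlogn : Real.log n ≤ n - 1 := Real.log_le_sub_one_of_pos (by linarith)
  have h12 : Real.log 12 ≤ 4 := by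
    have he : (2 : ℝ) ≤ Real.exp 1 := by
      have := Real.add_one_le_exp (1 : ℝ)
      linarith
    have he4 : (12 : ℝ) ≤ Real.exp 4 := by
      have : Real.exp 4 = (Real.exp 1) ^ 4 := by rw [← Real.exp_nat_mul]; norm_num
      rw [this]
      nlinarith [pow_le_pow_left₀ (by norm_num : (0 : ℝ) ≤ 2) he 4]
    calc Real.log 12 ≤ Real.log (Real.exp 4) := Real.log_le_log (by norm_num) he4
      _ = 4 := Real.log_exp 4
  rw [Real.log_mul (by norm_num) (by positivity)]
  push_cast
  nlinarith

/-- **The verdict on a thermal oracle's answer decides `SatIsing`** (Troyer–Wiese's low-temperature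
lemma `lowTemperature_thermalEnergy_decides_holds` with `E₀ = -N(z)`, `β = 3n + 3`, accuracy `1/4`).
[cite: TroyerWiese2005, Letter p. 4] -/
theorem verdict_eq_boolIndicator (O : Oracle) (hO : IsIsingThermalOracle O) (z : List Bool) :
    (decFn (boolPair z (O (qryFn z)))).headD false = (SatIsing : Set (List Bool)).boolIndicator z := by
  rw [qryFn_apply]
  obtain ⟨a, ha, hacc⟩ := hO ⟨nSpins z, matrixOf z⟩ (3 * nSpins z + 3) 3 (isUnitCoupling_J _)
  rw [ha, decFn_boolPair, List.headD_cons]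
  suffices key : a < 3 - 4 * (thresholdN z : ℤ) ↔ z ∈ SatIsing by
    by_cases hz : z ∈ SatIsing
    · rw [(Set.mem_iff_boolIndicator _ _).1 hz, decide_eq_true (key.2 hz)]
    · rw [(Set.notMem_iff_boolIndicator _ _).1 hz, decide_eq_false (mt key.1 hz)]
  have hlow := lowTemperature_thermalEnergy_decides_holds (nSpins z) (matrixOf z) (-(thresholdN z : ℤ))
    ((3 * nSpins z + 3 : ℕ) : ℝ) (isUnitCoupling_J _) (lowTemperature_le _ (by simp [nSpins]))
  have hacc' : |(a : ℝ) / 4 - isingThermalEnergy (matrixOf z) ((3 * nSpins z + 3 : ℕ) : ℝ)| ≤ 1 / 4 := by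
    norm_num at hacc ⊢
    exact hacc
  obtain ⟨hup, hdown⟩ := abs_sub_le_iff.1 hacc'
  push_cast at hup hdown hlow
  rw [mem_SatIsing_iff]
  constructor
  · intro hlt
    by_contra hno
    push Not at hno
    have h2 := hlow.2 hno
    have : (3 : ℝ) - 4 * (thresholdN z : ℝ) ≤ a := by linarith
    have : (3 : ℤ) - 4 * (thresholdN z : ℤ) ≤ a := by exact_mod_cast this
    omega
  · rintro hex
    have h1 := hlow.1 hex
    have : (a : ℝ) < 3 - 4 * (thresholdN z : ℝ) := by linarith
    exact_mod_cast this

/-- **`SatIsing ∈ P^O` for every thermal-energy oracle `O`.** [cite: TroyerWiese2005, Letter p. 4] -/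
theorem satIsing_mem_PRel (O : Oracle) (hO : IsIsingThermalOracle O) : SatIsing ∈ PRel O := by
  obtain ⟨s, hs⟩ := exists_poly_length_le_of_mem_FP qryFn_mem_FP
  refine ⟨signAlg, isPolyTime_signAlg, s + 2, fun x => ⟨?_, fun y hy => ?_⟩⟩
  · rw [run_signAlg O x (by simp [eval_add]; omega), verdict_eq_boolIndicator O hO x]
  · rw [eq_of_mem_queries_signAlg O x _ hy]
    exact (hs x).trans (by simp)

/-! ### The barrier -/

/-- **BARRIER `SignProblemNPHard` — discharged.** For every oracle `O` answering thermal energies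
of unit-coupling Ising systems at unary inverse temperature and accuracy (`IsIsingThermalOracle O`,
"a solution of the sign problem" for Troyer–Wiese's family), `NP ⊆ P^O`: an `NP` language
Karp-reduces to `SatIsing` (Cook–Levin, `satIsing_isNPHard`), hence Cook-reduces to it
(`PolyTimeKarpReducible.turing_holds`), and `SatIsing ∈ P^O` (`satIsing_mem_PRel`: one query at
`β = 3n + 3 ≥ n ln 2 + ln(12 n)`, Troyer–Wiese's low-temperature lemma), so it lies in `P^O` by the
closure of `P^O` under Cook reductions (`mem_PRel_of_polyTimeTuringReducible_holds`).
[cite: TroyerWiese2005, abstract and Letter p. 4] -/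
theorem SignProblemNPHard_holds : SignProblemNPHard := fun O hO L hL =>
  mem_PRel_of_polyTimeTuringReducible_holds (PolyTimeKarpReducible.turing_holds (satIsing_isNPHard L hL))
    (satIsing_mem_PRel O hO)

/-- Troyer–Wiese's reduction step in `SatIsing` form: thermal oracles decide the `NP`-hard
ground-state language `SatIsing` in polynomial time. [cite: TroyerWiese2005, Letter p. 4] -/
theorem signProblem_decides_satIsing : ∀ O : Oracle, IsIsingThermalOracle O → SatIsing ∈ PRel O :=
  satIsing_mem_PRel

end Literature.Barriers.HubbardSuperconductivity

end
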